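import Summits.BirchSwinnertonDyer.BirchSwinnertonDyer.Theses.UniversalToricDescent
import HarnessLib

/-!
# Route UniversalToricDescent, RK-6 v2 (pen pss3x g8, director (356)): the INTEGRAL wall ⟹ the RATIONAL wall, BY NAME

Width prover bsd-wall-utd-p1-w2 g5 (`--supports stmt-BirchSwinnertonDyer-24207`, helper). The new support item
`RationalSplitIMCInclusionAtThree` (stmt-BirchSwinnertonDyer-24207; 20395's binders VERBATIM, conclusion weakened to
`∃ k, 3^k·𝓛 ∈ Ch_Λ(X_{∅,0}(E/K_∞))·R₀⟦T⟧`) is implied by THE WALL `AdditiveSplitIMCInclusionAtThree` (stmt-BirchSwinnertonDyer-20395,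
conclusion `(𝓛) ⊆ Ch·R₀⟦T⟧`) with `k = 0` — the pen's sketch certificate `rationalSplitIMCInclusionAtThree_of_wall`, landed here as a
tree theorem so that the integral road (cruxlead-20395's thin_comb lines) is a SUFFICIENT road for the rational disjunct of the re-keyed
package `ToricDefectWallMuAtThree` in the kernel, by name.

THEOREMS ONLY; no definition, no named fact, no `sorry`. Closes nothing (24207 and 20395 stay OPEN); BSD is not advanced by this file.
-/

set_option autoImplicit false
-- `…BirchSwinnertonDyer.BirchSwinnertonDyer.Theorems…` is the problem's mandated namespace (D-0017).
set_option linter.dupNamespace false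

noncomputable section

namespace Summit.BirchSwinnertonDyer.BirchSwinnertonDyer.Theorems.UniversalToricDescentRationalSplitIMCInclusionAtThreeOfWall

open Summit.BirchSwinnertonDyer.BirchSwinnertonDyer.Theses.UniversalToricDescent

/-- **Integral wall ⟹ rational wall** (`k = 0`): `AdditiveSplitIMCInclusionAtThree → RationalSplitIMCInclusionAtThree`, BY NAME.
From `(𝓛) ⊆ Ch·R₀⟦T⟧` at a frame, `3⁰·𝓛 = 𝓛 ∈ Ch·R₀⟦T⟧`. [folklore] -/
theorem rationalSplitIMCInclusionAtThree_of_wall (hW : AdditiveSplitIMCInclusionAtThree) :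
    RationalSplitIMCInclusionAtThree := by
  unfold RationalSplitIMCInclusionAtThree
  unfold AdditiveSplitIMCInclusionAtThree at hW
  intro W _ _ N _ K _ _ Dt hO6 hsurj hrk hN hK hH κ hκ γ _ 𝔭 h𝔭 hram hdeg 𝔭' h𝔭' hne ι' hι ΩK Ωp L hΩK hΩp hL
  refine ⟨0, ?_⟩
  rw [pow_zero, one_mul]
  exact hW W N K Dt hO6 hsurj hrk hN hK hH κ hκ γ 𝔭 h𝔭 hram hdeg 𝔭' h𝔭' hne ι' hι ΩK Ωp L hΩK hΩp hL
    (Ideal.mem_span_singleton_self L)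

/-- **Pointwise form** (one frame at a time, the shape the rational road's kernel consumes): an integral inclusion
`(L) ⊆ I` gives the rational membership `∃ k, 3^k·L ∈ I` with `k = 0`, for any ideal `I` of `R₀⟦T⟧`. [folklore] -/
theorem exists_pow_mul_mem_of_span_le {I : Ideal (Literature.NumberTheory.EllipticCurves.UnrSeries 3)}
    {L : Literature.NumberTheory.EllipticCurves.UnrSeries 3} (h : Ideal.span {L} ≤ I) :
    ∃ k : ℕ, ((3 : ℕ) : Literature.NumberTheory.EllipticCurves.UnrSeries 3) ^ k * L ∈ I :=
  ⟨0, by rw [pow_zero, one_mul]; exact h (Ideal.mem_span_singleton_self L)⟩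

end Summit.BirchSwinnertonDyer.BirchSwinnertonDyer.Theorems.UniversalToricDescentRationalSplitIMCInclusionAtThreeOfWall

end
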